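import Literature.Computability.AlgebraicComplexity.DegenerationSpectralMonotone
import HarnessLib

/-!
# The free-lunch speedup `T ⊕ T' ⊴ S` (Alman–Li 2026, Thm. 5.1), explicit form

Topic `Literature/Computability/AlgebraicComplexity` (family `MatrixMultiplication`). Source: J. Alman,
B. Li, *Asymptotic Rank Speedup Theorems, Revisited*, arXiv:2605.21738 (2026), §5.1, Theorem 5.1
("Free-lunch speedup") with its printed two-step proof (held text `paper:arxiv-2605.21738`, p. 12).

## The printed statement (p. 12)

"Let `T ∈ U' ⊗ V' ⊗ W'` and `S ∈ U ⊗ V ⊗ W` be two tensors, with a restriction `T ≤ S` given by the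
maps `(A, B, C)`. Let `C^⊥ ⊆ W^∨` be the subspace of linear functions `f : W → 𝔽` such that
`(A ⊗ B ⊗ f) S = 0`. For any chosen subspace `C' ⊆ C^⊥`, define the subspaces `A' ⊆ U^∨` and
`B' ⊆ V^∨` as follows: `A' = {u ∈ U^∨ : (u ⊗ B ⊗ C') S = 0}`, `B' = {v ∈ V^∨ : (A ⊗ v ⊗ C') S = 0}`.
Then we have the direct sum degeneration `T ⊕ T' ⊴ S`, where `T' = (A' ⊗ B' ⊗ C') S`."

## The form proved here (coordinates; every commutative semiring `K`)

Tensors are `ι → κ → μ → K` as everywhere in this directory; a restriction datum is a triple of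
matrices `A : ι' → ι → K`, `B : κ' → κ → K`, `C : μ' → μ → K` with
`T a' b' c' = ∑_{a,b,c} A a' a · B b' b · C c' c · S a b c` (`TensorRestrictsTo`,
`AsymptoticSpectrum.lean`), and a degeneration of order `h` is a triple of polynomial matrices over
`K[ε]` (`IsApproxRestriction h`, `AlgDegeneratesTo`; `DegenerationSpectralMonotone.lean`, BCS (15.19)).
In these terms Thm. 5.1 reads (`AlmanLi2026.thm51`): for matrices `C' : ν → μ → K` (rows = the chosen
functionals in `C^⊥`), `A' : α → ι → K` (rows in the printed subspace `A'`), `B' : β → κ → K` (rows in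
`B'`), i.e. subject to the three vanishing conditions
`(A ⊗ B ⊗ C') S = 0`, `(A' ⊗ B ⊗ C') S = 0`, `(A ⊗ B' ⊗ C') S = 0`,
one has `T ⊕ T' ⊴ S` with `T' = (A' ⊗ B' ⊗ C') S`, by the EXPLICIT degeneration of order `2`
(`AlmanLi2026.isApproxRestriction_freeLunch`, matrices written inline) whose three polynomial matrices are the printed ones,
Step 1 (block maps `(A; A')`, `(B; B')`, `(C; C')`) composed with Step 2 (the monomial degeneration
`diag(1, ε) ⊗ diag(1, ε) ⊗ diag(ε², 1)`):
`Â = (A ; ε A')`, `B̂ = (B ; ε B')`, `Ĉ = (ε² C ; C')`, so that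
`(Â ⊗ B̂ ⊗ Ĉ) S = ε² (T ⊕ T') + O(ε³)` — the blocks `112`, `212`, `122` vanish identically by the
three conditions, the blocks `121`, `211`, `221` carry `ε³, ε³, ε⁴` (the "junk terms" of Step 2).
Taking for the rows of `A'`, `B'` bases of the printed subspaces gives the printed `T'`; any spanning
families give a restriction-equivalent tensor, and arbitrary families of vectors in those subspaces
give restrictions of it, so the matrix form is the printed theorem with the choice of bases made
explicit.  No subtraction is used: the statement holds over every commutative semiring.

APPEND 1 adds **Cor. 5.1** (the degeneration version) in the same coordinates: degeneration data
`(A(ε) ⊗ B(ε) ⊗ C(ε)) S = ε^h T + O(ε^{h+1})` (`IsApproxRestriction h`), polynomial `C', A', B'` with the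
three vanishing conditions exact over `K[ε]`, `T'` the lowest-order term of `(A' ⊗ B' ⊗ C') S`
⟹ `T ⊕ T' ⊴ S` (`AlmanLi2026.cor51`, explicit order `2h + h' + 2`:
`AlmanLi2026.isApproxRestriction_freeLunch_degen`).

What is NOT here: Prop. 5.3 (the rank count `t ≥ r − n − m` for a single functional) and Prop. 5.4
(appending a slice), hence not the sharp Thm. 6.1; the weak one-slice instance used by the tree is
`OneSliceSpeedup.lean`.

## References

* J. Alman, B. Li, *Asymptotic Rank Speedup Theorems, Revisited*, arXiv:2605.21738 (2026), Thm. 5.1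
  and its proof, Cor. 5.1 (p. 12). [AlmanLi2026]
* P. Bürgisser, M. Clausen, M. A. Shokrollahi, *Algebraic Complexity Theory* (1997), (15.19)–(15.20)
  (degeneration of order `h`). [BurgisserClausenShokrollahi1997]
-/

noncomputable section

open scoped BigOperators Polynomial
open Polynomial

namespace Literature.Computability.AlgebraicComplexity

universe u

variable {K : Type u} [CommSemiring K]
variable {ι κ μ ι' κ' μ' α β ν : Type*}

namespace AlmanLi2026

/-! ## The three polynomial matrices of the printed proof (Step 1 composed with Step 2)

They are written inline in the statements below (no auxiliary definitions):
`Â = (A ; ε·A') : K[ε]^{(ι' ⊕ α) × ι}` is `fun r a => Sum.elim (fun a' => C (A a' a) · ε⁰) (fun x => C (A' x a) · ε¹) r`,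
`B̂ = (B ; ε·B')` likewise, and `Ĉ = (ε²·C ; C')` is
`fun r c => Sum.elim (fun c' => C (C c' c) · ε²) (fun z => C (C' z c) · ε⁰) r`. -/

/-- One block of `(Â ⊗ B̂ ⊗ Ĉ) S`: monomial weights multiply, coefficients contract.
[folklore] -/
private theorem sum_weighted_eq [Fintype ι] [Fintype κ] [Fintype μ] (eA eB eC : ℕ) (P : ι → K)
    (Q : κ → K) (R : μ → K) (S : ι → κ → μ → K) :
    (∑ a, ∑ b, ∑ c, (Polynomial.C (P a) * X ^ eA) * (Polynomial.C (Q b) * X ^ eB) *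
        (Polynomial.C (R c) * X ^ eC) * Polynomial.C (S a b c)) =
      Polynomial.C (∑ a, ∑ b, ∑ c, P a * Q b * R c * S a b c) * X ^ (eA + eB + eC) := by
  simp only [map_sum, Finset.sum_mul]
  refine Finset.sum_congr rfl fun a _ => Finset.sum_congr rfl fun b _ =>
    Finset.sum_congr rfl fun c _ => ?_
  simp only [map_mul, pow_add]
  ring

/-- Coefficients of a weighted constant `C v · ε^e` in degrees `j ≤ 2`: `v` if `j = e`, else `0`;
packaged for the eight block checks below. [folklore] -/
private theorem coeff_C_mul_X_pow_eq (v : K) (e j : ℕ) :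
    (Polynomial.C v * X ^ e).coeff j = if j = e then v else 0 := by
  rw [Polynomial.coeff_C_mul_X_pow]

/-- **The free-lunch degeneration, explicitly** (Alman–Li 2026, proof of Thm. 5.1): with
`T = (A ⊗ B ⊗ C) S`, `T' = (A' ⊗ B' ⊗ C') S` and the three vanishing conditions
`(A ⊗ B ⊗ C') S = 0`, `(A' ⊗ B ⊗ C') S = 0`, `(A ⊗ B' ⊗ C') S = 0`, the polynomial matrices
`Â = (A ; εA')`, `B̂ = (B ; εB')`, `Ĉ = (ε²C ; C')` realise a degeneration of order `2`,
`(Â ⊗ B̂ ⊗ Ĉ) S = ε² (T ⊕ T') + O(ε³)`. [cite: AlmanLi2026, Thm. 5.1 (proof)] -/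
theorem isApproxRestriction_freeLunch [Fintype ι] [Fintype κ] [Fintype μ] {S : ι → κ → μ → K}
    {A : ι' → ι → K} {B : κ' → κ → K} {C₀ : μ' → μ → K} {A' : α → ι → K} {B' : β → κ → K}
    {C' : ν → μ → K} {T : ι' → κ' → μ' → K} {T' : α → β → ν → K}
    (hT : ∀ a' b' c', T a' b' c' = ∑ a, ∑ b, ∑ c, A a' a * B b' b * C₀ c' c * S a b c)
    (hT' : ∀ x y z, T' x y z = ∑ a, ∑ b, ∑ c, A' x a * B' y b * C' z c * S a b c)
    (hC' : ∀ a' b' z, (∑ a, ∑ b, ∑ c, A a' a * B b' b * C' z c * S a b c) = 0)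
    (hA' : ∀ x b' z, (∑ a, ∑ b, ∑ c, A' x a * B b' b * C' z c * S a b c) = 0)
    (hB' : ∀ a' y z, (∑ a, ∑ b, ∑ c, A a' a * B' y b * C' z c * S a b c) = 0) :
    IsApproxRestriction 2 S (directSumTensor T T')
      (fun r a => Sum.elim (fun a' => Polynomial.C (A a' a) * X ^ 0)
        (fun x => Polynomial.C (A' x a) * X ^ 1) r)
      (fun r b => Sum.elim (fun b' => Polynomial.C (B b' b) * X ^ 0)
        (fun y => Polynomial.C (B' y b) * X ^ 1) r)
      (fun r c => Sum.elim (fun c' => Polynomial.C (C₀ c' c) * X ^ 2)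
        (fun z => Polynomial.C (C' z c) * X ^ 0) r) := by
  rintro (a' | x) (b' | y) (c' | z) j hj <;>
    simp only [Sum.elim_inl, Sum.elim_inr, sum_weighted_eq, coeff_C_mul_X_pow_eq]
  · -- block 111: weight ε², coefficient T
    simp [hT]
  · -- block 112: weight ε⁰, coefficient (A ⊗ B ⊗ C') S = 0
    rw [hC']; simp
  · -- block 121: weight ε³ (junk)
    have : j ≠ 0 + 1 + 2 := by omega
    simp [this]
  · -- block 122: weight ε¹, coefficient (A ⊗ B' ⊗ C') S = 0
    rw [hB']; simp
  · -- block 211: weight ε³ (junk)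
    have : j ≠ 1 + 0 + 2 := by omega
    simp [this]
  · -- block 212: weight ε¹, coefficient (A' ⊗ B ⊗ C') S = 0
    rw [hA']; simp
  · -- block 221: weight ε⁴ (junk)
    have : j ≠ 1 + 1 + 2 := by omega
    simp [this, directSumTensor]
  · -- block 222: weight ε², coefficient T'
    simp [hT']

/-- **Alman–Li 2026, Thm. 5.1 (free-lunch speedup)**, in coordinates over any commutative semiring:
let `T = (A ⊗ B ⊗ C) S` be a restriction of `S`, let the rows of `C'` be functionals with
`(A ⊗ B ⊗ C') S = 0` (i.e. in `C^⊥`), and let the rows of `A'`, `B'` lie in the printed subspaces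
`{u : (u ⊗ B ⊗ C') S = 0}`, `{v : (A ⊗ v ⊗ C') S = 0}`. Then `T ⊕ T' ⊴ S` for
`T' = (A' ⊗ B' ⊗ C') S` (with bases of those subspaces as rows, `T'` is the printed
`(A' ⊗ B' ⊗ C') S`). [cite: AlmanLi2026, Thm. 5.1] -/
theorem thm51 [Fintype ι] [Fintype κ] [Fintype μ] {S : ι → κ → μ → K}
    {A : ι' → ι → K} {B : κ' → κ → K} {C₀ : μ' → μ → K} {A' : α → ι → K} {B' : β → κ → K}
    {C' : ν → μ → K} {T : ι' → κ' → μ' → K} {T' : α → β → ν → K}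
    (hT : ∀ a' b' c', T a' b' c' = ∑ a, ∑ b, ∑ c, A a' a * B b' b * C₀ c' c * S a b c)
    (hT' : ∀ x y z, T' x y z = ∑ a, ∑ b, ∑ c, A' x a * B' y b * C' z c * S a b c)
    (hC' : ∀ a' b' z, (∑ a, ∑ b, ∑ c, A a' a * B b' b * C' z c * S a b c) = 0)
    (hA' : ∀ x b' z, (∑ a, ∑ b, ∑ c, A' x a * B b' b * C' z c * S a b c) = 0)
    (hB' : ∀ a' y z, (∑ a, ∑ b, ∑ c, A a' a * B' y b * C' z c * S a b c) = 0) :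
    AlgDegeneratesTo S (directSumTensor T T') :=
  ⟨2, _, _, _, isApproxRestriction_freeLunch hT hT' hC' hA' hB'⟩


/-! ## Cor. 5.1 — the degeneration version, in coordinates (APPEND 1)

p. 12 (after Thm. 5.1): "the degeneration version is obtained by bootstrapping the result: It is not
using any specific property of degeneration, but just regarding it as a restriction over the field
extension `𝔽(λ)`."  **Corollary 5.1 (Free-lunch speedup, degeneration version).** "Let `T ⊴ S` be a
degeneration of `𝔽`-tensors. More specifically, let `T_λ` be a `𝔽(λ)`-tensor before taking `λ → 0`,
i.e., `T + O(λ) = T_λ = (A_λ ⊗ B_λ ⊗ C_λ)S` is the restriction of `𝔽(λ)`-tensors. Plug in `T ≤ S`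
with data `A_λ, B_λ` and `C_λ` into (thm:freelunch_speedup), for any choice of `C'` thereby, let the
resulting `𝔽(λ)` tensor be `T'_λ`, `T'` be the lowest order term of `T'_λ` (`0` if `T'_λ` is completely
zero). Then [`T ⊕ T' ⊴ S`]."

In the tree's coordinates (BCS (15.19): `(A(ε) ⊗ B(ε) ⊗ C(ε)) S = ε^h T + O(ε^{h+1})` is
`IsApproxRestriction h S T A B C`) this reads (`AlmanLi2026.cor51`): given POLYNOMIAL matrices
`A, B, C` realising `T ⊴_h S`, polynomial matrices `C', A', B'` satisfying the three vanishing
conditions EXACTLY over `K[ε]` (functionals in `C^⊥` and vectors of the annihilator subspaces over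
`𝔽(ε)`, denominators cleared — scaling a functional by a nonzero polynomial keeps it in the subspace),
and `T'` the order-`h'` coefficient tensor of `T'_ε = (A' ⊗ B' ⊗ C') S` with all lower coefficients
zero (`IsApproxRestriction h' S T' A' B' C'` — for `h'` = the exact order this is "the lowest order
term", for smaller `h'` it forces `T' = 0`, the printed convention), one has `T ⊕ T' ⊴ S`, by the
explicit degeneration of order `2h + h' + 2` with the re-weighted block matrices
`Â = (A ; ε^{h+1} A')`, `B̂ = (B ; ε^{h+1} B')`, `Ĉ = (ε^{h+h'+2} C ; C')`
(`AlmanLi2026.isApproxRestriction_freeLunch_degen`): block `111` has weight `h+h'+2` on an order-`h`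
entry, block `222` weight `2h+2` on an order-`h'` entry, blocks `112/212/122` vanish identically, and
the junk blocks `121/211/221` carry weights `2h+h'+3`, `2h+h'+3`, `3h+h'+4`, all beyond the order. -/

/-- One block of `(Â ⊗ B̂ ⊗ Ĉ) S` for monomially re-weighted POLYNOMIAL matrices. [folklore] -/
private theorem sum_weighted_poly_eq [Fintype ι] [Fintype κ] [Fintype μ] (eA eB eC : ℕ)
    (P : ι → K[X]) (Q : κ → K[X]) (R : μ → K[X]) (S : ι → κ → μ → K) :
    (∑ a, ∑ b, ∑ c, (P a * X ^ eA) * (Q b * X ^ eB) * (R c * X ^ eC) * Polynomial.C (S a b c)) =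
      X ^ (eA + eB + eC) * ∑ a, ∑ b, ∑ c, P a * Q b * R c * Polynomial.C (S a b c) := by
  simp only [Finset.mul_sum]
  refine Finset.sum_congr rfl fun a _ => Finset.sum_congr rfl fun b _ =>
    Finset.sum_congr rfl fun c _ => ?_
  simp only [pow_add]
  ring

/-- **The free-lunch degeneration from degeneration data, explicitly** (Alman–Li 2026, Cor. 5.1 by
the bootstrapping remark of p. 12): from `(A ⊗ B ⊗ C) S = ε^h T + O(ε^{h+1})`,
`(A' ⊗ B' ⊗ C') S = ε^{h'} T' + O(ε^{h'+1})` and the exact vanishing of `(A ⊗ B ⊗ C') S`,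
`(A' ⊗ B ⊗ C') S`, `(A ⊗ B' ⊗ C') S` over `K[ε]`, the matrices `Â = (A ; ε^{h+1} A')`,
`B̂ = (B ; ε^{h+1} B')`, `Ĉ = (ε^{h+h'+2} C ; C')` give
`(Â ⊗ B̂ ⊗ Ĉ) S = ε^{2h+h'+2} (T ⊕ T') + O(ε^{2h+h'+3})`. [cite: AlmanLi2026, Cor. 5.1 (with the proof of Thm. 5.1)] -/
theorem isApproxRestriction_freeLunch_degen [Fintype ι] [Fintype κ] [Fintype μ] {h h' : ℕ}
    {S : ι → κ → μ → K} {A : ι' → ι → K[X]} {B : κ' → κ → K[X]} {C₀ : μ' → μ → K[X]}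
    {A' : α → ι → K[X]} {B' : β → κ → K[X]} {C' : ν → μ → K[X]} {T : ι' → κ' → μ' → K}
    {T' : α → β → ν → K} (hT : IsApproxRestriction h S T A B C₀)
    (hT' : IsApproxRestriction h' S T' A' B' C')
    (hC' : ∀ a' b' z, (∑ a, ∑ b, ∑ c, A a' a * B b' b * C' z c * Polynomial.C (S a b c)) = 0)
    (hA' : ∀ x b' z, (∑ a, ∑ b, ∑ c, A' x a * B b' b * C' z c * Polynomial.C (S a b c)) = 0)
    (hB' : ∀ a' y z, (∑ a, ∑ b, ∑ c, A a' a * B' y b * C' z c * Polynomial.C (S a b c)) = 0) :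
    IsApproxRestriction (2 * h + h' + 2) S (directSumTensor T T')
      (fun r a => Sum.elim (fun a' => A a' a * X ^ 0) (fun x => A' x a * X ^ (h + 1)) r)
      (fun r b => Sum.elim (fun b' => B b' b * X ^ 0) (fun y => B' y b * X ^ (h + 1)) r)
      (fun r c => Sum.elim (fun c' => C₀ c' c * X ^ (h + h' + 2)) (fun z => C' z c * X ^ 0) r) := by
  rintro (a' | x) (b' | y) (c' | z) j hj <;>
    simp only [Sum.elim_inl, Sum.elim_inr, sum_weighted_poly_eq, Polynomial.coeff_X_pow_mul']
  · -- block 111: weight h+h'+2 on an order-h entry with leading coefficient T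
    have e : 0 + 0 + (h + h' + 2) = h + h' + 2 := by ring
    rw [e]
    by_cases hle : h + h' + 2 ≤ j
    · rw [if_pos hle, hT a' b' c' (j - (h + h' + 2)) (by omega)]
      by_cases hj' : j = 2 * h + h' + 2
      · rw [if_pos (by omega), if_pos hj', directSumTensor_inl]
      · rw [if_neg (by omega), if_neg hj']
    · rw [if_neg hle, if_neg (by omega)]
  · -- block 112: (A ⊗ B ⊗ C') S = 0
    rw [hC']; simp
  · -- block 121: junk, weight 2h+h'+3
    rw [if_neg (by omega)]; simp
  · -- block 122: (A ⊗ B' ⊗ C') S = 0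
    rw [hB']; simp
  · -- block 211: junk, weight 2h+h'+3
    rw [if_neg (by omega)]; simp
  · -- block 212: (A' ⊗ B ⊗ C') S = 0
    rw [hA']; simp
  · -- block 221: junk, weight 3h+h'+4
    rw [if_neg (by omega)]; simp [directSumTensor]
  · -- block 222: weight 2h+2 on an order-h' entry with leading coefficient T'
    have e : h + 1 + (h + 1) + 0 = 2 * h + 2 := by ring
    rw [e]
    by_cases hle : 2 * h + 2 ≤ j
    · rw [if_pos hle, hT' x y z (j - (2 * h + 2)) (by omega)]
      by_cases hj' : j = 2 * h + h' + 2
      · rw [if_pos (by omega), if_pos hj', directSumTensor_inr]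
      · rw [if_neg (by omega), if_neg hj']
    · rw [if_neg hle, if_neg (by omega)]

/-- **Alman–Li 2026, Cor. 5.1 (free-lunch speedup, degeneration version)**, in coordinates over any
commutative semiring: if polynomial matrices `A, B, C` realise the degeneration `T ⊴ S`
(`(A ⊗ B ⊗ C) S = ε^h T + O(ε^{h+1})`), the rows of the polynomial matrix `C'` are functionals with
`(A ⊗ B ⊗ C') S = 0` over `K[ε]`, the rows of `A'`, `B'` satisfy `(A' ⊗ B ⊗ C') S = 0`,
`(A ⊗ B' ⊗ C') S = 0` over `K[ε]`, and `T'` is the order-`h'` term of `T'_ε = (A' ⊗ B' ⊗ C') S`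
with vanishing lower terms, then `T ⊕ T' ⊴ S`. [cite: AlmanLi2026, Cor. 5.1] -/
theorem cor51 [Fintype ι] [Fintype κ] [Fintype μ] {h h' : ℕ}
    {S : ι → κ → μ → K} {A : ι' → ι → K[X]} {B : κ' → κ → K[X]} {C₀ : μ' → μ → K[X]}
    {A' : α → ι → K[X]} {B' : β → κ → K[X]} {C' : ν → μ → K[X]} {T : ι' → κ' → μ' → K}
    {T' : α → β → ν → K} (hT : IsApproxRestriction h S T A B C₀)
    (hT' : IsApproxRestriction h' S T' A' B' C')
    (hC' : ∀ a' b' z, (∑ a, ∑ b, ∑ c, A a' a * B b' b * C' z c * Polynomial.C (S a b c)) = 0)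
    (hA' : ∀ x b' z, (∑ a, ∑ b, ∑ c, A' x a * B b' b * C' z c * Polynomial.C (S a b c)) = 0)
    (hB' : ∀ a' y z, (∑ a, ∑ b, ∑ c, A a' a * B' y b * C' z c * Polynomial.C (S a b c)) = 0) :
    AlgDegeneratesTo S (directSumTensor T T') :=
  ⟨_, _, _, _, isApproxRestriction_freeLunch_degen hT hT' hC' hA' hB'⟩

end AlmanLi2026

end Literature.Computability.AlgebraicComplexity
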